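import Summits.QuantumFields.YangMills.Theorems.BalabanUVNodesN20TwoRunKeyedGoodFibre

/-!
# BalabanUVNodes ∕ N20 (NE7b) — THE GOOD-CLASS KEYED MASSES AT NODE U5d's TWO-RUN SITE KEYS, ONE PAIR OF RUNS: off ANY bad class of σ-keys whose run-A complement has
# `Ω_1 = T_η` — in particular off `Node00`'s persistence class `badKeysSigma F (T K) jcut`, `jcut K ≥ 1` — run B's good keyed mass is the LIFTED-TERM mass over run A's good
# indices (`RAgree`), and at the persistence class BOTH runs' good masses live on ONE index set `{s : Λ_{jcut K} = T_η}`: run A as `wA s`, run B as `wB (liftSeq s)`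

Cell `pub-ymgap` (HUMAN RULING D-0062 Track A; work-bound push D-0149, director-ym №197), width seat `pub-ymgap-dag-n20-w2` (gen 0) on node N20 = NE7b; third module of plan g77
`W-SEAT-START-LIST.md` §2 n20 ITEM 2's theme (module 1 `…N20TwoRunKeyedPersistentWeight` p584315: the BAD keys; module 2 `…N20TwoRunKeyedGoodFibre` p586099: the fibre over a key
without old activity is ONE lifted term; this module: the GOOD-class MASSES), typed on the live -c lane's view (dag-n20-c g17 LANE-VIEW-W2, pub-ymgap INBOX 2026-08-27: «(S4) feeds
the core edge's good-class pairing; `Bad`-generic + `badKeysSigma` corollary so it survives either pin of `θ.ppSel`»).  Filed `--kind proof --supports stmt-QuantumFields-20544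
--as helper` (K3⁷ `SpineGivenEndpointR13SepCoPH`); COUNT-NEUTRAL.  [III] = [Balaban1988Convergent], [LF-I] = [Balaban1989LargeFieldI].  (α) READING as in module 1.

WHY.  N19's core edge `hedge` (n19-d B p571597 :169; dag-n20-w3's companions p584566 ∕ p585901) and U4′'s `hlt` quantify over the GOOD class `T K ∖ Bad K t` of the σ-packed
two-run keys, comparing run A's keyed weight with run B's keyed (FIBRE) weight key by key.  Module 2 showed the fibre over a run-A index with `Ω_1 = T_η` is `{liftSeq s}`.  Here:
* §1 (under `RAgree`) truncation ∕ lift on the SINGLE-LEVEL small-field classes: `truncSeq_Λ_eq_univ_iff` · `liftSeq_Λ_succ_eq_univ_iff` · `eq_liftSeq_truncSeq_of_Ω_one` ·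
  `eq_liftSeq_truncSeq_of_Λ_succ_eq_univ` · ★ `filter_Λ_succ_eq_univ_eq_image_liftSeq` (run B's indices with `Λ'_{j+1} = T_η` are EXACTLY the lifts of run A's with `Λ_j = T_η`,
  `1 ≤ j ≤ k`) · `liftSeq_injective` · ★ `sum_filter_Λ_succ_eq_univ_eq_sum_liftSeq` (`Σ_{s' : Λ'_{j+1} = T_η} w s' = Σ_{s : Λ_j = T_η} w (liftSeq s)`);
* §2 ONE PAIR OF RUNS, `Bad` GENERIC (any finset of σ-keys), ANY weights: `sum_sdiff_fiberA_eq_sum_filter` ∕ `sum_sdiff_fiberB_eq_sum_filter` (flow-free: the good keyed masses are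
  the term sums over the indices whose key is not bad) · ★ `filter_keyB_not_mem_eq_image_liftSeq` (under `RAgree`, if every GOOD run-A index has `Ω_1 = T_η`: run B's good indices =
  the lifts of run A's good indices) · ★★ `sum_sdiff_fiberB_eq_sum_liftSeq` (`Σ_{x ∈ T∖Bad} B x = Σ_{s : kA s ∉ Bad} w (liftSeq s)`);
* §3 THE INSTANCE `Bad := badKeysSigma F T jcut` (policy `1 ≤ jcut K ≤ K₀ + K`; the `Ω_1 = T_η` hypothesis is dag-n20-d's `Λ_eq_univ_of_mem_sdiff_badKeysSigma_twoRunKeyA`):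
  `sum_sdiff_badKeysSigma_fiberA_eq` (run A: `Σ_{s : Λ_{jcut K} = T_η} wA s`) · ★★ `sum_sdiff_badKeysSigma_fiberB_eq_sum_liftSeq` (run B: `Σ_{s : Λ_{jcut K} = T_η} wB (liftSeq s)`)
  — the complements of module 1's ★ `sum_badKeysSigma_fiberA_eq` ∕ `…fiberB_eq`; so on the good class U4′ and the core edge compare run A's (2.18) TERM with run B's LIFTED TERM
  over ONE finite index set.
  Plus the converse direction asked by ref-O READ-18 NIT-1 (on module 2), typed: `sigma_twoRunKeyA_mem_badKeysSigma_of_Ω_one_ne_univ` — a run-A index with `Ω_1 ≠ T_η` is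
  old-bad for every policy `jcut K ≥ 1`, so run B's level-1 freedom lives over BAD keys only.
Cited BY NAME, not re-typed: modules 1–2, dag-n20-d `Node00/TwoRunSite{Transport,Key,Lift,Persistence}` (`truncSeq_Λ∕_Ω`, `liftSeq`, `truncSeq_liftSeq`, `liftSeq_Λ_succ_ne_univ_iff`,
`Λ_eq_univ_of_mem_sdiff_badKeysSigma_twoRunKeyA`), n19-d B §1 (`sigma_twoRunKeyB_eq_sigma_twoRunKeyA_truncSeq`), `B14Eq218Concrete.Chain21.Λ_subset_Ω_of_le`.

HONEST FRAMING.  Finite bookkeeping + torus geometry (Mathlib + tree shapes BY NAME); NO weight is bounded, NO estimate proved; it only puts the GOOD-class comparison of N19 ∕ U4′ on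
one index set.  dag-n20-w3's LOCATED-1 (INBOX 2026-08-27) stands: at the (2.18) index the persistence class reads «large field CREATED at a level ≤ jcut», whose good class is
asymptotically weightless by a volume count at an identity∕junk pin of `θ.ppSel` — these identities hold for EVERY bad class (§2) and decide no pin.  Nothing of Bałaban's is
asserted; NE7 ∕ NE7b ∕ NE7c NOT PRINTED for `d = 4`, NOT proved; (α)-instance 0∕1; N19 ∕ N20 ∕ N21 ∕ N27 NOT discharged; K3⁷ NOT closed; counts unmoved (typed 28∕28 · discharged
5∕27); no count claim.  One finite `𝕋⁴_{L^K}` programme at fixed `ε = L^{−K}` along two consecutive cutoffs, Bałaban AS PRINTED; the YM mass gap (Clay) is NOT proved by any of this —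
R4 closes the conditional finite-𝕋⁴ rung `BalabanLadder.UV` only; NOT ℝ⁴, NOT OS.  No `def`, no `instance`, no `notation`, no `sorry`.
Sources (bookkeeping): [III] (2.1) p.254, (2.5) p.255, (2.18) p.257; [LF-I] (0.2)–(0.4) p.176; [King1986] (3.10) p.656.
-/

noncomputable section

open scoped BigOperators

namespace Summit.QuantumFields.YangMills.BalabanUVNodes.N20TwoRunKeyedGoodClassMass

open Literature.MathematicalPhysics.QuantumFieldTheory.Balaban1983to89 Literature.MathematicalPhysics.QuantumFieldTheory.Balaban1983to89.Node00
open T4Continuum B14.Eq213MaximalDomains B15Eq112TorusCover B14DomainGeom B14.Eq218Concrete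
open Summit.QuantumFields.YangMills.BalabanUVNodes.N20TwoRunKeyedPersistentWeight
  (blockDownSet_seq_Λ_succ_eq_univ_iff sigma_twoRunKeyA_mem_badKeysSigma_iff)
open Summit.QuantumFields.YangMills.BalabanUVNodes.N20TwoRunKeyedGoodFibre (truncSeq_eq_iff_eq_liftSeq_of_Ω_one)

variable (F : T4Family)

/-! ## §1  Under `RAgree`: truncation and lift on the single-level small-field classes -/

section Agree

variable (ν : Stage7Numerics) {M : ℕ} (hM : 0 < M) {gA gB : ℕ → ℝ} {K k : ℕ} (hR : RAgree F ν gA gB k)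

/-- The truncation reads run B's large-field regions one level up: `(truncSeq s').Λ_j = T_η ↔ s'.Λ_{j+1} = T_η` on the window (module 1 §1's exactness).
[cite: Balaban1988Convergent, (2.1) p.254, (2.18) p.257 (bookkeeping)] -/
theorem truncSeq_Λ_eq_univ_iff (s' : SeqOfRecord F ν M gB (K + 1) (k + 1)) {j : ℕ} (h1 : 1 ≤ j) (hj : j ≤ k) :
    (truncSeq F ν hM hR s').Λ j = Set.univ ↔ s'.Λ (j + 1) = Set.univ := by
  rw [truncSeq_Λ F ν hM hR s' h1 hj]
  exact blockDownSet_seq_Λ_succ_eq_univ_iff F ν M gB s' hj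

/-- The lift reads run A's large-field regions one level down: `(liftSeq s).Λ_{j+1} = T_η ↔ s.Λ_j = T_η` on the window (`Node00.liftSeq_Λ_succ_ne_univ_iff`).
[cite: Balaban1988Convergent, (2.18) p.257 (bookkeeping)] -/
theorem liftSeq_Λ_succ_eq_univ_iff (s : SeqOfRecord F ν M gA K k) {j : ℕ} (h1 : 1 ≤ j) (hj : j ≤ k) :
    (liftSeq F ν hM hR s).Λ (j + 1) = Set.univ ↔ s.Λ j = Set.univ :=
  not_iff_not.1 (liftSeq_Λ_succ_ne_univ_iff F ν hM hR s h1 hj)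

/-- **A RUN-B INDEX WHOSE TRUNCATION HAS `Ω_1 = T_η` IS THE LIFT OF ITS TRUNCATION** (`k ≥ 1`; module 2's singleton read at `s := truncSeq s'`).
[cite: Balaban1988Convergent, (2.5) p.255, (2.18) p.257 (bookkeeping)] -/
theorem eq_liftSeq_truncSeq_of_Ω_one (hk : 1 ≤ k) (s' : SeqOfRecord F ν M gB (K + 1) (k + 1)) (h : (truncSeq F ν hM hR s').Ω 1 = Set.univ) :
    s' = liftSeq F ν hM hR (truncSeq F ν hM hR s') :=
  (truncSeq_eq_iff_eq_liftSeq_of_Ω_one F ν hM hR hk (truncSeq F ν hM hR s') h s').1 rfl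

/-- **A RUN-B INDEX WITH NO LARGE FIELD AT SOME LEVEL `j + 1 ≥ 2` IS THE LIFT OF ITS TRUNCATION** (`1 ≤ j ≤ k`): `Λ'_{j+1} = T_η ⇒ Ω'_2 = T_η` by (2.1), so
`(truncSeq s').Ω_1 = blockDownSet Ω'_2 = T_η`. [cite: Balaban1988Convergent, (2.1) p.254, (2.5) p.255, (2.18) p.257 (bookkeeping)] -/
theorem eq_liftSeq_truncSeq_of_Λ_succ_eq_univ (s' : SeqOfRecord F ν M gB (K + 1) (k + 1)) {j : ℕ} (h1 : 1 ≤ j) (hj : j ≤ k)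
    (h : s'.Λ (j + 1) = Set.univ) : s' = liftSeq F ν hM hR (truncSeq F ν hM hR s') := by
  have hΩ2 : s'.Ω 2 = Set.univ :=
    Set.eq_univ_of_univ_subset (h ▸ s'.chain.Λ_subset_Ω_of_le (j := 2) (j' := j + 1) (by omega) (by omega) (by omega))
  refine eq_liftSeq_truncSeq_of_Ω_one F ν hM hR (h1.trans hj) s' ?_
  rw [truncSeq_Ω F ν hM hR s' le_rfl (h1.trans hj), hΩ2, blockDownSet_univ]

open Classical in
/-- **★ THE LIFT IS A BIJECTION FROM RUN A's SMALL-FIELD CLASS AT LEVEL `j` ONTO RUN B's AT LEVEL `j + 1`** (`1 ≤ j ≤ k`): the admissible run-B indices with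
`Λ'_{j+1} = T_η` are EXACTLY the lifts of the admissible run-A indices with `Λ_j = T_η`. [cite: Balaban1988Convergent, (2.1) p.254, (2.5) p.255, (2.18) p.257 (bookkeeping)] -/
theorem filter_Λ_succ_eq_univ_eq_image_liftSeq {j : ℕ} (h1 : 1 ≤ j) (hj : j ≤ k) :
    Finset.univ.filter (fun s' : SeqOfRecord F ν M gB (K + 1) (k + 1) => s'.Λ (j + 1) = Set.univ)
      = (Finset.univ.filter (fun s : SeqOfRecord F ν M gA K k => s.Λ j = Set.univ)).image (liftSeq F ν hM hR) := by
  ext s'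
  simp only [Finset.mem_filter, Finset.mem_univ, true_and, Finset.mem_image]
  constructor
  · intro h
    exact ⟨truncSeq F ν hM hR s', (truncSeq_Λ_eq_univ_iff F ν hM hR s' h1 hj).2 h, (eq_liftSeq_truncSeq_of_Λ_succ_eq_univ F ν hM hR s' h1 hj h).symm⟩
  · rintro ⟨s, hs, rfl⟩
    exact (liftSeq_Λ_succ_eq_univ_iff F ν hM hR s h1 hj).2 hs

/-- The lift is injective (a section of `truncSeq`: `Node00.truncSeq_liftSeq`). [cite: Balaban1988Convergent, (2.18) p.257 (bookkeeping)] -/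
theorem liftSeq_injective : Function.Injective (liftSeq F ν hM hR (K := K)) :=
  Function.LeftInverse.injective (truncSeq_liftSeq F ν hM hR)

open Classical in
/-- **★ ANY WEIGHT SUMMED OVER RUN B's SMALL-FIELD CLASS AT LEVEL `j + 1` IS THE SUM OF ITS LIFTED VALUES OVER RUN A's CLASS AT LEVEL `j`** (`1 ≤ j ≤ k`):
`Σ_{s' : Λ'_{j+1} = T_η} w s' = Σ_{s : Λ_j = T_η} w (liftSeq s)`. [cite: Balaban1988Convergent, (2.18) p.257; King1986, (3.10) p.656 (bookkeeping)] -/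
theorem sum_filter_Λ_succ_eq_univ_eq_sum_liftSeq {j : ℕ} (h1 : 1 ≤ j) (hj : j ≤ k) {β : Type*} [AddCommMonoid β]
    (w : SeqOfRecord F ν M gB (K + 1) (k + 1) → β) :
    ∑ s' ∈ Finset.univ.filter (fun s' : SeqOfRecord F ν M gB (K + 1) (k + 1) => s'.Λ (j + 1) = Set.univ), w s'
      = ∑ s ∈ Finset.univ.filter (fun s : SeqOfRecord F ν M gA K k => s.Λ j = Set.univ), w (liftSeq F ν hM hR s) := by
  rw [filter_Λ_succ_eq_univ_eq_image_liftSeq F ν hM hR h1 hj, Finset.sum_image fun _ _ _ _ h => liftSeq_injective F ν hM hR h]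

end Agree

/-! ## §2  ONE PAIR OF RUNS, `Bad` GENERIC: the GOOD-class keyed masses of the two runs as term sums -/

section OnePair

variable (ν : Stage7Numerics) {M : ℕ} (hM : 0 < M) (K₀ : ℕ) [∀ Kc, DecidableEq (SiteSeqKey F Kc)]

/-- **RUN A's GOOD-CLASS KEYED MASS, ANY BAD CLASS** (flow-free): over the keys of a class set `T ⊇` run A's keys OFF an arbitrary bad class `Bad`, run A's keyed fibre weights sum to
the weights of the run-A indices whose key is not bad (`kA` injective: `Finset.sum_fiberwise_eq_sum_filter`). [cite: Balaban1988Convergent, (2.18) p.257; King1986, (3.10) p.656 (bookkeeping)] -/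
theorem sum_sdiff_fiberA_eq_sum_filter (gA : ℕ → ℝ) (T Bad : Finset (Σ K, SiteSeqKey F (K₀ + K))) (K : ℕ) {k : ℕ}
    (hT : ∀ s : SeqOfRecord F ν M gA (K₀ + K) k, (⟨K, twoRunKeyA F ν M gA (K₀ + K) k s⟩ : Σ K, SiteSeqKey F (K₀ + K)) ∈ T)
    {β : Type*} [AddCommMonoid β] (w : SeqOfRecord F ν M gA (K₀ + K) k → β) :
    ∑ x ∈ T \ Bad, ∑ s ∈ Finset.univ.filter (fun s : SeqOfRecord F ν M gA (K₀ + K) k =>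
        (⟨K, twoRunKeyA F ν M gA (K₀ + K) k s⟩ : Σ K, SiteSeqKey F (K₀ + K)) = x), w s
      = ∑ s ∈ Finset.univ.filter (fun s : SeqOfRecord F ν M gA (K₀ + K) k =>
          (⟨K, twoRunKeyA F ν M gA (K₀ + K) k s⟩ : Σ K, SiteSeqKey F (K₀ + K)) ∉ Bad), w s := by
  rw [Finset.sum_fiberwise_eq_sum_filter]
  refine Finset.sum_congr (Finset.filter_congr fun s _ => ?_) fun _ _ => rfl
  rw [Finset.mem_sdiff, and_iff_right (hT s)]

/-- **RUN B's GOOD-CLASS KEYED MASS, ANY BAD CLASS** (flow-free): the same for run B's block-down key (cutoff `K₀ + K + 1`). [cite: Balaban1988Convergent, (2.18) p.257; King1986, (3.10) p.656 (bookkeeping)] -/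
theorem sum_sdiff_fiberB_eq_sum_filter (gB : ℕ → ℝ) (T Bad : Finset (Σ K, SiteSeqKey F (K₀ + K))) (K : ℕ) {k : ℕ}
    (hT : ∀ s' : SeqOfRecord F ν M gB (K₀ + K + 1) (k + 1), (⟨K, twoRunKeyB F ν hM gB (K₀ + K) k s'⟩ : Σ K, SiteSeqKey F (K₀ + K)) ∈ T)
    {β : Type*} [AddCommMonoid β] (w : SeqOfRecord F ν M gB (K₀ + K + 1) (k + 1) → β) :
    ∑ x ∈ T \ Bad, ∑ s' ∈ Finset.univ.filter (fun s' : SeqOfRecord F ν M gB (K₀ + K + 1) (k + 1) =>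
        (⟨K, twoRunKeyB F ν hM gB (K₀ + K) k s'⟩ : Σ K, SiteSeqKey F (K₀ + K)) = x), w s'
      = ∑ s' ∈ Finset.univ.filter (fun s' : SeqOfRecord F ν M gB (K₀ + K + 1) (k + 1) =>
          (⟨K, twoRunKeyB F ν hM gB (K₀ + K) k s'⟩ : Σ K, SiteSeqKey F (K₀ + K)) ∉ Bad), w s' := by
  rw [Finset.sum_fiberwise_eq_sum_filter]
  refine Finset.sum_congr (Finset.filter_congr fun s' _ => ?_) fun _ _ => rfl
  rw [Finset.mem_sdiff, and_iff_right (hT s')]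

open Classical in
/-- **★ UNDER `RAgree`, IF EVERY GOOD RUN-A INDEX HAS `Ω_1 = T_η`, RUN B's GOOD INDICES ARE EXACTLY THE LIFTS OF RUN A's GOOD INDICES** (any bad class of σ-keys; `K₀ + K ≥ 1`):
`kB s' ∉ Bad` iff `s' = liftSeq s` for a (unique) run-A index with `kA s ∉ Bad` — `kB = kA ∘ truncSeq` (n19-d), the good truncation has `Ω_1 = T_η` by hypothesis, and module 2's
singleton fixes `s'`. [cite: Balaban1988Convergent, (2.5) p.255, (2.18) p.257 (bookkeeping)] -/
theorem filter_keyB_not_mem_eq_image_liftSeq {gA gB : ℕ → ℕ → ℝ} {K : ℕ} (hR : RAgree F ν (gA K) (gB K) (K₀ + K)) (hk : 1 ≤ K₀ + K)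
    (Bad : Finset (Σ K, SiteSeqKey F (K₀ + K)))
    (hgood : ∀ s : SeqOfRecord F ν M (gA K) (K₀ + K) (K₀ + K),
      (⟨K, twoRunKeyA F ν M (gA K) (K₀ + K) (K₀ + K) s⟩ : Σ K, SiteSeqKey F (K₀ + K)) ∉ Bad → s.Ω 1 = Set.univ) :
    Finset.univ.filter (fun s' : SeqOfRecord F ν M (gB K) (K₀ + K + 1) (K₀ + K + 1) =>
        (⟨K, twoRunKeyB F ν hM (gB K) (K₀ + K) (K₀ + K) s'⟩ : Σ K, SiteSeqKey F (K₀ + K)) ∉ Bad)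
      = (Finset.univ.filter (fun s : SeqOfRecord F ν M (gA K) (K₀ + K) (K₀ + K) =>
          (⟨K, twoRunKeyA F ν M (gA K) (K₀ + K) (K₀ + K) s⟩ : Σ K, SiteSeqKey F (K₀ + K)) ∉ Bad)).image (liftSeq F ν hM hR) := by
  ext s'
  simp only [Finset.mem_filter, Finset.mem_univ, true_and, Finset.mem_image]
  constructor
  · intro h
    have hkey := N19TargetClassWeightsTwoRunKeyed.sigma_twoRunKeyB_eq_sigma_twoRunKeyA_truncSeq F ν K₀ hM hR s'
    rw [hkey] at h
    exact ⟨truncSeq F ν hM hR s', h, (N20TwoRunKeyedGoodClassMass.eq_liftSeq_truncSeq_of_Ω_one F ν hM hR hk s' (hgood _ h)).symm⟩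
  · rintro ⟨s, hs, rfl⟩
    rwa [N19TargetClassWeightsTwoRunKeyed.sigma_twoRunKeyB_eq_sigma_twoRunKeyA_truncSeq F ν K₀ hM hR, truncSeq_liftSeq]

open Classical in
/-- **★★ RUN B's GOOD-CLASS KEYED MASS IS THE LIFTED-TERM MASS OVER RUN A's GOOD INDICES — ANY BAD CLASS whose complement has `Ω_1 = T_η` on run A's side** (under `RAgree`,
`K₀ + K ≥ 1`, class set `T ⊇` run B's keys, ANY weight `w`): `Σ_{x ∈ T ∖ Bad} B x = Σ_{s : kA s ∉ Bad} w (liftSeq s)`.  With `sum_sdiff_fiberA_eq_sum_filter` this puts BOTH runs'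
good-class masses on ONE finite index set — run A's term `s` against run B's lifted term `liftSeq s` — whichever pin of `θ.ppSel` the bad class is read at.
[cite: Balaban1989LargeFieldI, (0.2)–(0.4) p.176; Balaban1988Convergent, (2.5) p.255, (2.18) p.257; King1986, (3.10) p.656 (bookkeeping)] -/
theorem sum_sdiff_fiberB_eq_sum_liftSeq {gA gB : ℕ → ℕ → ℝ} {K : ℕ} (hR : RAgree F ν (gA K) (gB K) (K₀ + K)) (hk : 1 ≤ K₀ + K)
    (T Bad : Finset (Σ K, SiteSeqKey F (K₀ + K)))
    (hT : ∀ s' : SeqOfRecord F ν M (gB K) (K₀ + K + 1) (K₀ + K + 1),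
      (⟨K, twoRunKeyB F ν hM (gB K) (K₀ + K) (K₀ + K) s'⟩ : Σ K, SiteSeqKey F (K₀ + K)) ∈ T)
    (hgood : ∀ s : SeqOfRecord F ν M (gA K) (K₀ + K) (K₀ + K),
      (⟨K, twoRunKeyA F ν M (gA K) (K₀ + K) (K₀ + K) s⟩ : Σ K, SiteSeqKey F (K₀ + K)) ∉ Bad → s.Ω 1 = Set.univ)
    {β : Type*} [AddCommMonoid β] (w : SeqOfRecord F ν M (gB K) (K₀ + K + 1) (K₀ + K + 1) → β) :
    ∑ x ∈ T \ Bad, ∑ s' ∈ Finset.univ.filter (fun s' : SeqOfRecord F ν M (gB K) (K₀ + K + 1) (K₀ + K + 1) =>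
        (⟨K, twoRunKeyB F ν hM (gB K) (K₀ + K) (K₀ + K) s'⟩ : Σ K, SiteSeqKey F (K₀ + K)) = x), w s'
      = ∑ s ∈ Finset.univ.filter (fun s : SeqOfRecord F ν M (gA K) (K₀ + K) (K₀ + K) =>
          (⟨K, twoRunKeyA F ν M (gA K) (K₀ + K) (K₀ + K) s⟩ : Σ K, SiteSeqKey F (K₀ + K)) ∉ Bad), w (liftSeq F ν hM hR s) := by
  rw [sum_sdiff_fiberB_eq_sum_filter F ν hM K₀ (gB K) T Bad K hT w, filter_keyB_not_mem_eq_image_liftSeq F ν hM K₀ hR hk Bad hgood,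
    Finset.sum_image fun _ _ _ _ h => liftSeq_injective F ν hM hR h]

end OnePair

/-! ## §3  The instance `Bad := badKeysSigma F T jcut` (policy `1 ≤ jcut K ≤ K₀ + K`): single-level forms; the `Ω_1 = T_η` hypothesis is dag-n20-d's
`Λ_eq_univ_of_mem_sdiff_badKeysSigma_twoRunKeyA` -/

section Persistence

variable (ν : Stage7Numerics) {M : ℕ} (hM : 0 < M) (K₀ : ℕ) [∀ Kc, DecidableEq (SiteSeqKey F Kc)]

open Classical in
/-- **RUN A's GOOD-CLASS KEYED MASS AT THE PERSISTENCE CLASS** = the weights of the run-A indices with NO large-field region at level `jcut K` (so, by (2.1), none at any level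
`≤ jcut K`). [cite: Balaban1989LargeFieldI, (0.2) p.176; Balaban1988Convergent, (2.1) p.254, (2.18) p.257; King1986, (3.10) p.656 (bookkeeping)] -/
theorem sum_sdiff_badKeysSigma_fiberA_eq (gA : ℕ → ℝ) (T : Finset (Σ K, SiteSeqKey F (K₀ + K))) (jcut : ℕ → ℕ) (K : ℕ) {k : ℕ}
    (h1 : 1 ≤ jcut K) (hj : jcut K ≤ k) (hT : ∀ s : SeqOfRecord F ν M gA (K₀ + K) k, (⟨K, twoRunKeyA F ν M gA (K₀ + K) k s⟩ : Σ K, SiteSeqKey F (K₀ + K)) ∈ T)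
    {β : Type*} [AddCommMonoid β] (w : SeqOfRecord F ν M gA (K₀ + K) k → β) :
    ∑ x ∈ T \ badKeysSigma F T jcut, ∑ s ∈ Finset.univ.filter (fun s : SeqOfRecord F ν M gA (K₀ + K) k =>
        (⟨K, twoRunKeyA F ν M gA (K₀ + K) k s⟩ : Σ K, SiteSeqKey F (K₀ + K)) = x), w s
      = ∑ s ∈ Finset.univ.filter (fun s : SeqOfRecord F ν M gA (K₀ + K) k => s.Λ (jcut K) = Set.univ), w s := by
  rw [sum_sdiff_fiberA_eq_sum_filter F ν K₀ gA T _ K hT w]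
  refine Finset.sum_congr (Finset.filter_congr fun s _ => ?_) fun _ _ => rfl
  rw [sigma_twoRunKeyA_mem_badKeysSigma_iff F ν M gA T jcut K h1 hj s (hT s), not_not]

open Classical in
/-- **★★ RUN B's GOOD-CLASS KEYED MASS AT THE PERSISTENCE CLASS IS THE LIFTED-TERM MASS OVER RUN A's SINGLE-LEVEL SMALL-FIELD CLASS** (under `RAgree`; policy
`1 ≤ jcut K ≤ K₀ + K`; class set `T ⊇` BOTH runs' keys; ANY weight `w`): `Σ_{x ∈ T ∖ badKeysSigma} B x = Σ_{s : Λ_{jcut K} = T_η} w (liftSeq s)` — §2 with dag-n20-d's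
`Λ_eq_univ_of_mem_sdiff_badKeysSigma_twoRunKeyA` supplying `Ω_1 = T_η` on the good class.  With `sum_sdiff_badKeysSigma_fiberA_eq`: the two runs' GOOD masses live on THE SAME index set
`{s : s.Λ (jcut K) = T_η}`, run A as `wA s`, run B as `wB (liftSeq s)`. [cite: Balaban1989LargeFieldI, (0.2)–(0.4) p.176; Balaban1988Convergent, (2.1) p.254, (2.18) p.257; King1986, (3.10) p.656 (bookkeeping)] -/
theorem sum_sdiff_badKeysSigma_fiberB_eq_sum_liftSeq {gA gB : ℕ → ℕ → ℝ} {K : ℕ} (hR : RAgree F ν (gA K) (gB K) (K₀ + K))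
    (T : Finset (Σ K, SiteSeqKey F (K₀ + K))) (jcut : ℕ → ℕ) (h1 : 1 ≤ jcut K) (hj : jcut K ≤ K₀ + K)
    (hTA : ∀ s : SeqOfRecord F ν M (gA K) (K₀ + K) (K₀ + K), (⟨K, twoRunKeyA F ν M (gA K) (K₀ + K) (K₀ + K) s⟩ : Σ K, SiteSeqKey F (K₀ + K)) ∈ T)
    (hTB : ∀ s' : SeqOfRecord F ν M (gB K) (K₀ + K + 1) (K₀ + K + 1),
      (⟨K, twoRunKeyB F ν hM (gB K) (K₀ + K) (K₀ + K) s'⟩ : Σ K, SiteSeqKey F (K₀ + K)) ∈ T)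
    {β : Type*} [AddCommMonoid β] (w : SeqOfRecord F ν M (gB K) (K₀ + K + 1) (K₀ + K + 1) → β) :
    ∑ x ∈ T \ badKeysSigma F T jcut, ∑ s' ∈ Finset.univ.filter (fun s' : SeqOfRecord F ν M (gB K) (K₀ + K + 1) (K₀ + K + 1) =>
        (⟨K, twoRunKeyB F ν hM (gB K) (K₀ + K) (K₀ + K) s'⟩ : Σ K, SiteSeqKey F (K₀ + K)) = x), w s'
      = ∑ s ∈ Finset.univ.filter (fun s : SeqOfRecord F ν M (gA K) (K₀ + K) (K₀ + K) => s.Λ (jcut K) = Set.univ), w (liftSeq F ν hM hR s) := by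
  have hgood : ∀ s : SeqOfRecord F ν M (gA K) (K₀ + K) (K₀ + K),
      (⟨K, twoRunKeyA F ν M (gA K) (K₀ + K) (K₀ + K) s⟩ : Σ K, SiteSeqKey F (K₀ + K)) ∉ badKeysSigma F T jcut → s.Ω 1 = Set.univ :=
    fun s hs => (Λ_eq_univ_of_mem_sdiff_badKeysSigma_twoRunKeyA F ν M (gA K) T jcut K (K₀ + K) s
      (Finset.mem_sdiff.2 ⟨hTA s, hs⟩) le_rfl h1).2 (h1.trans hj)
  rw [sum_sdiff_fiberB_eq_sum_liftSeq F ν hM K₀ hR (h1.trans hj) T _ hTB hgood w]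
  refine Finset.sum_congr (Finset.filter_congr fun s _ => ?_) fun _ _ => rfl
  rw [sigma_twoRunKeyA_mem_badKeysSigma_iff F ν M (gA K) T jcut K h1 hj s (hTA s), not_not]

omit [∀ Kc, DecidableEq (SiteSeqKey F Kc)] in
/-- **THE OTHER DIRECTION (ref-O READ-18 NIT-1 on module 2, typed): A RUN-A INDEX WITH `Ω_1 ≠ T_η` IS OLD-BAD FOR EVERY POLICY `1 ≤ jcut K ≤ k`** — by (2.1)
`Λ_{jcut K} ⊆ Λ_1 ⊆ Ω_1`, so `Λ_{jcut K} ≠ T_η`, i.e. its σ-key lies in `badKeysSigma F T jcut` (module 1 `sigma_twoRunKeyA_mem_badKeysSigma_iff`); hence run B's level-1 freedom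
(module 2: the fibre is NOT a singleton only when `Ω_1 ≠ T_η`) lives entirely over BAD keys. [cite: Balaban1988Convergent, (2.1) p.254, (2.18) p.257; Balaban1989LargeFieldII, (1.80) p.384 (bookkeeping)] -/
theorem sigma_twoRunKeyA_mem_badKeysSigma_of_Ω_one_ne_univ (gA : ℕ → ℝ) (T : Finset (Σ K, SiteSeqKey F (K₀ + K))) (jcut : ℕ → ℕ) (K : ℕ) {k : ℕ}
    (h1 : 1 ≤ jcut K) (hj : jcut K ≤ k) (s : SeqOfRecord F ν M gA (K₀ + K) k)
    (hT : (⟨K, twoRunKeyA F ν M gA (K₀ + K) k s⟩ : Σ K, SiteSeqKey F (K₀ + K)) ∈ T) (hΩ : s.Ω 1 ≠ Set.univ) :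
    (⟨K, twoRunKeyA F ν M gA (K₀ + K) k s⟩ : Σ K, SiteSeqKey F (K₀ + K)) ∈ badKeysSigma F T jcut := by
  refine (sigma_twoRunKeyA_mem_badKeysSigma_iff F ν M gA T jcut K h1 hj s hT).2 fun hΛ => hΩ (Set.eq_univ_of_univ_subset ?_)
  rw [← hΛ]
  exact s.chain.Λ_subset_Ω_of_le le_rfl h1 hj

end Persistence

end Summit.QuantumFields.YangMills.BalabanUVNodes.N20TwoRunKeyedGoodClassMass

end
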